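import Mathlib
import Literature.Computability.AlgebraicComplexity.HessianAtOrigin
import Literature.Computability.AlgebraicComplexity.MignonRessayreBound
import Summits.ValiantsHypothesis.ValiantsHypothesis.Theorems.GrenetZeonTwoDimCoefficientsDefs
import Summits.ValiantsHypothesis.ValiantsHypothesis.Theorems.GrenetZeonTwoDimCoefficientsTraceChainProfile
import Summits.ValiantsHypothesis.ValiantsHypothesis.Theorems.GrenetZeonTwoDimCoefficientsDualUnipotentTraceProduct

/-!
# Crux `GrenetZeon.TwoDimCoefficients` (stmt-ValiantsHypothesis-8062), stub `stub_dualUnipotent`: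
# the stub does not follow from the Hessian profile of the permanent

The line `dim2_cases` closes every case of the crux by ONE mechanism: a zero `p` of `per_n` with
large Hessian rank (`rank Hess per_n(p) > n²/2` from the dependency crux `HessianRankCodimTwo`, or
`= n²` at the Mignon–Ressayre point) against a pointwise bound `rank ≤ O(m)` for the representing
object.  Its only open stub is the unipotent trace model (`DualUnipotentBound`:
`per_n = α + β·tr(adj A·B)`, `det A ≡ c ≠ 0`, affine `m × m` ⟹ `n² ≤ C·m`), where val-width-8062-p3
showed the pointwise bound fails for the degree-2 witness `tr(X·Xᵀ)` (`…DualUnipotentHessianBlind`).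
This file closes the remaining loophole ("but `per_n` is homogeneous of high degree with a
non-degenerate zero — restrict the method to such representations"): it is not a loophole.

* `perPoly_hessianProfile` — the permanent's profile (tree, Mignon–Ressayre): `per_n` (`n ≥ 3`) is
  homogeneous of degree `n` and has a zero with Hessian of full rank `n²`.
* `dualUnipotentBound_iff` — `DualUnipotentBound` is VERBATIM the instance `f := per_n` of the
  statement `(P)`: "`∃ C n₀, ∀ n ≥ n₀, ∀ m`, every `f ∈ ℂ[x_{ij}]_{i,j<n}` with a unipotent trace
  representation of size `m` has `n² ≤ C·m`".
* `chainPoly_repr`, `chainPoly_profile` — for `n = s²` (`s ≥ 3`) the trace chain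
  `tr(X₀ X₁ ⋯ X_{n-1})` of `n` generic `s × s` blocks, written in the variables `x_{(a,⟨i,j⟩)}` of
  the crux, has a unipotent trace representation of size `m = n·s = n^{3/2}` (the chain embedding
  `exists_chain_embedding` of `…DualUnipotentTraceProduct`, val-width-8062-p1) AND the permanent's
  profile: homogeneous of degree `n`, a zero with Hessian of full rank `n²`
  (`traceChain_hessianProfile` of `…TraceChainProfile`, this seat).
* `not_dualUnipotentBound_of_hessianProfile` — **MAIN**: the statement `(P)` restricted to `f`
  with the permanent's profile is FALSE.  Consequently no proof of `stub_dualUnipotent` can use of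
  `per_n` only (homogeneity, degree `n`, `n²` variables, a zero — or a dense set of zeros — of
  Hessian rank `≥ θn²`): the trace chain has all of these in width `n^{3/2} = o(n²)`; and the
  line's pointwise-Hessian method yields at best `m ≳ n^{3/2}` in the unipotent case (the chain's
  rate `rank = m²/n` is attained).  What WOULD be needed is a property separating `per_n` from
  `tr(X₀ ⋯ X_{n-1})`, `w = √n` — e.g. a super-`n^{3/2}` trace-product-width lower bound for the
  permanent, itself not in print (`…DualUnipotentTraceProduct`, calibration).

HONEST FRAMING: a theorem about the METHOD (and about an explicit polynomial the model computes),
not about the permanent; `DualUnipotentBound` and the crux stay open; `VP ≠ VNP` is not moved.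

References: T. Mignon, N. Ressayre, Int. Math. Res. Not. 2004:79, Thm. 1.1 (key
`MignonRessayre2004`); J. M. Landsberg, *Geometry and Complexity Theory* (2017), §6.4 and §6.3.3
(Question 6.3.3.7: the codimension of the singular locus of the permanent is unknown — the input a
Kumar/Chatterjee–Kumar–She–Volk-type cut argument would need here); L. G. Valiant, STOC 1979, §2.
-/

-- single-conjunct layout `Summits/ValiantsHypothesis/ValiantsHypothesis`: the duplicated namespace
-- component is mandated by the tree.
set_option linter.dupNamespace false

noncomputable section

namespace Summit.ValiantsHypothesis.ValiantsHypothesis.Cruxes.TwoDimCoefficients.DimTwoCases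

open Literature.Computability.AlgebraicComplexity Matrix MvPolynomial

/-! ### Renaming variables along an equivalence: translation and Hessian -/

section Rename

variable {σ τ : Type}

/-- Translation commutes with renaming: `(rename e f)(X + x) = rename e (f(X + x ∘ e))`.
[folklore] -/
theorem transl_rename_eq (e : σ → τ) (x : τ → ℂ) (f : MvPolynomial σ ℂ) :
    transl x (rename e f) = rename e (transl (x ∘ e) f) := by
  have h : (transl x).comp (rename e) = (rename e).comp (transl (x ∘ e)) := by
    refine MvPolynomial.algHom_ext fun v => ?_
    simp only [AlgHom.comp_apply, rename_X, transl_X, map_add, rename_C, Function.comp_apply]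
  exact congrArg (fun φ : MvPolynomial σ ℂ →ₐ[ℂ] MvPolynomial τ ℂ => φ f) h

/-- The Hessian at the origin of a renamed polynomial is the re-indexed Hessian. [folklore] -/
theorem hess0_rename_equiv (e : σ ≃ τ) (f : MvPolynomial σ ℂ) :
    hess0 (rename e f) = Matrix.reindex e e (hess0 f) := by
  ext s t
  rw [Matrix.reindex_apply, Matrix.submatrix_apply, hess0_apply, hess0_apply,
    ← e.apply_symm_apply t, pderiv_rename e.injective, ← e.apply_symm_apply s,
    pderiv_rename e.injective, constantCoeff_rename, e.symm_apply_apply, e.symm_apply_apply]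

/-- Rank of the Hessian at a point is invariant under renaming the variables along an
equivalence. [folklore] -/
theorem rank_hess0_transl_rename_equiv [Fintype σ] [Fintype τ] (e : σ ≃ τ) (x : τ → ℂ)
    (f : MvPolynomial σ ℂ) :
    (hess0 (transl x (rename e f))).rank = (hess0 (transl (x ∘ e) f)).rank := by
  rw [transl_rename_eq, hess0_rename_equiv, Matrix.rank_reindex]

end Rename

/-! ### Ordered products: `List.ofFn` versus the prefix products of the trace chain -/

/-- `(X₀ :: ⋯ :: X_{d-1}).prod` is the prefix product `pprod B d` when `X a = B a`. [folklore] -/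
theorem ofFn_prod_eq_pprod {R : Type} [Semiring R] {w : ℕ} :
    ∀ (d : ℕ) (X : Fin d → Matrix (Fin w) (Fin w) R) (B : ℕ → Matrix (Fin w) (Fin w) R),
      (∀ a : Fin d, X a = B a) → (List.ofFn X).prod = TraceChain.pprod w B d := by
  intro d
  induction d with
  | zero => intro X B _; simp
  | succ d ih =>
    intro X B h
    rw [List.ofFn_succ', List.concat_eq_append, List.prod_append, List.prod_singleton,
      TraceChain.pprod_succ, ih (fun i => X (Fin.castSucc i)) B (fun a => h _), h (Fin.last d)]
    rfl

/-! ### The permanent has the profile; the stub is its instance -/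

/-- **The Hessian profile of the permanent** (Mignon–Ressayre): `per_n` (`n = m + 3 ≥ 3`) is
homogeneous of degree `n` and has a zero (the Mignon–Ressayre point) at which its Hessian has full
rank `n²`. [cite: MignonRessayre2004, Thm. 1.1] -/
theorem perPoly_hessianProfile (m : ℕ) :
    (perPoly (Fin (m + 3)) ℂ).IsHomogeneous (m + 3) ∧
      ∃ p : Fin (m + 3) × Fin (m + 3) → ℂ, eval p (perPoly (Fin (m + 3)) ℂ) = 0 ∧
        (hess0 (transl p (perPoly (Fin (m + 3)) ℂ))).rank = (m + 3) ^ 2 := by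
  refine ⟨?_, mrPoint ℂ m, eval_mrPoint_perPoly, ?_⟩
  · have h := perPoly_isHomogeneous (n := Fin (m + 3)) (k := ℂ)
    rwa [Fintype.card_fin] at h
  · rw [hess0_transl_mrPoint_perPoly, rank_smul_eq (by exact_mod_cast Nat.factorial_ne_zero m),
      rank_mrHess]

/-- `DualUnipotentBound` is, verbatim, the instance `f := per_n` of the statement refuted below
for general `f` (the representation hypothesis unfolded). [folklore] -/
theorem dualUnipotentBound_iff :
    DualUnipotentBound ↔
      ∃ C n₀ : ℕ, ∀ n ≥ n₀, ∀ m : ℕ,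
        (∃ (α β c : ℂ) (A B : AffMat n m), IsAffine A ∧ IsAffine B ∧ c ≠ 0 ∧
            A.det = MvPolynomial.C c ∧
            perPoly (Fin n) ℂ = MvPolynomial.C α * A.det + MvPolynomial.C β * (A.adjugate * B).trace) →
        n ^ 2 ≤ C * m :=
  Iff.rfl

/-! ### The trace chain in the crux's coordinates -/

section Instance

open TraceChain

variable (k s : ℕ) (hk : s * s = k + 1)

/-- Block coordinates: `Fin s × Fin s ≃ Fin (k+1)` for `s² = k + 1`. [folklore] -/
def blockEquiv : Fin s × Fin s ≃ Fin (k + 1) := finProdFinEquiv.trans (finCongr hk)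

/-- The variable renaming `(a, i, j) ↦ (a, ⟨i, j⟩)` from the trace chain's variables to the
crux's `Fin n × Fin n`, `n = k + 1 = s²`. [folklore] -/
def varEquiv : Var (k + 1) s ≃ Fin (k + 1) × Fin (k + 1) :=
  Equiv.prodCongr (Equiv.refl _) (blockEquiv k s hk)

/-- The trace chain `tr(X₀ ⋯ X_k)` written in the crux's variables `x_{(a, ⟨i,j⟩)}`. [folklore] -/
def chainPoly : MvPolynomial (Fin (k + 1) × Fin (k + 1)) ℂ :=
  rename (varEquiv k s hk) (traceChain (k + 1) s)

/-- The affine (indeed linear) factors `X_a = (x_{(a, ⟨i,j⟩)})_{i,j}` of the chain in the crux's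
coordinates. [folklore] -/
def chainFactor (a : Fin (k + 1)) : AffMat (k + 1) s :=
  Matrix.of fun i j => X (a, blockEquiv k s hk (i, j))

/-- The factors are affine. [folklore] -/
theorem isAffine_chainFactor (a : Fin (k + 1)) : IsAffine (chainFactor k s hk a) := by
  intro i j
  simp only [chainFactor, Matrix.of_apply]
  exact (totalDegree_X _).le

/-- The renamed trace chain is the trace of the ordered product of the factors. [folklore] -/
theorem trace_prod_chainFactor :
    ((List.ofFn (chainFactor k s hk)).prod).trace = chainPoly k s hk := by
  rw [chainPoly, traceChain, AddMonoidHom.map_trace (rename (varEquiv k s hk)),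
    ofFn_prod_eq_pprod (k + 1) (chainFactor k s hk)
      (fun a => if h : a < k + 1 then chainFactor k s hk ⟨a, h⟩ else 0)
      (fun a => by simp only [dif_pos a.isLt, Fin.eta])]
  congr 1
  refine ((pprod_map (rename (varEquiv k s hk)).toRingHom (blk (k + 1) s) (k + 1)).trans
    (pprod_congr _ _ _ fun a ha => ?_)).symm
  rw [dif_pos ha]
  refine Matrix.ext fun i j => ?_
  simp only [blk, dif_pos ha, Matrix.map_apply, Matrix.of_apply, chainFactor]
  show rename (varEquiv k s hk) (X (⟨a, ha⟩, i, j)) = _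
  rw [rename_X]
  rfl

/-- **The renamed trace chain has a unipotent trace representation of size `(k+1)·s`.**
[folklore] -/
theorem chainPoly_repr :
    ∃ (α β c : ℂ) (A B : AffMat (k + 1) ((k + 1) * s)), IsAffine A ∧ IsAffine B ∧ c ≠ 0 ∧
      A.det = MvPolynomial.C c ∧
      chainPoly k s hk = MvPolynomial.C α * A.det + MvPolynomial.C β * (A.adjugate * B).trace := by
  obtain ⟨A, B, -, -, hA, hB, -, -, hdet, htr⟩ :=
    exists_chain_embedding (chainFactor k s hk) (isAffine_chainFactor k s hk)
  refine ⟨0, 1, 1, A, B, hA, hB, one_ne_zero, hdet, ?_⟩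
  rw [htr, trace_prod_chainFactor, map_zero, zero_mul, zero_add, map_one, one_mul]

/-- **The renamed trace chain has the Hessian profile of the permanent** (`s ≥ 3`): homogeneous
of degree `n = k + 1`, with a zero at which the Hessian has full rank `n²`. [folklore] -/
theorem chainPoly_profile (hs : 3 ≤ s) :
    (chainPoly k s hk).IsHomogeneous (k + 1) ∧
      ∃ p : Fin (k + 1) × Fin (k + 1) → ℂ, eval p (chainPoly k s hk) = 0 ∧
        (hess0 (transl p (chainPoly k s hk))).rank = (k + 1) ^ 2 := by
  have hd : 2 ≤ k + 1 := by nlinarith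
  obtain ⟨hhom, p, hp0, hrank⟩ := traceChain_hessianProfile (d := k + 1) (w := s) hd hs
  refine ⟨(hhom.rename_isHomogeneous : _), p ∘ (varEquiv k s hk).symm, ?_, ?_⟩
  · rw [chainPoly, eval_rename]
    simpa [Function.comp_def] using hp0
  · rw [chainPoly, rank_hess0_transl_rename_equiv]
    have hpe : (p ∘ (varEquiv k s hk).symm) ∘ (varEquiv k s hk) = p := by
      funext v; simp
    rw [hpe, hrank, ← hk]
    ring

end Instance

/-! ### The barrier -/

/-- **`DualUnipotentBound` does not follow from the Hessian profile of the permanent.**  The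
statement obtained from the stub by replacing `per_n` with an ARBITRARY polynomial `f` in the same
`n²` variables having the permanent's profile — homogeneous of degree `n`, with a zero at which the
Hessian has full rank `n²` (Mignon–Ressayre; what `HessianRankCodimTwo` feeds the line, and more)
— is FALSE: for `n = s²` the trace chain `tr(X₀ ⋯ X_{n-1})` of `n` generic `s × s` blocks has that
profile (`chainPoly_profile`) and a unipotent trace representation of size `m = n·s = n^{3/2}`
(`chainPoly_repr`), and `n² ≤ C·n^{3/2}` fails for `s > C`.  Hence every proof of
`stub_dualUnipotent` must use a property of `per_n` beyond this profile, and the pointwise Hessian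
method of the line (`stub_splitCase` / `stub_dualCase`) yields at best `m ≳ n^{3/2}` in the
unipotent case.  A statement about the METHOD; the stub stays open; `VP ≠ VNP` is not moved.
[folklore] -/
theorem not_dualUnipotentBound_of_hessianProfile :
    ¬ ∃ C n₀ : ℕ, ∀ n ≥ n₀, ∀ (m : ℕ) (f : MvPolynomial (Fin n × Fin n) ℂ),
        f.IsHomogeneous n →
        (∃ p : Fin n × Fin n → ℂ, eval p f = 0 ∧ (hess0 (transl p f)).rank = n ^ 2) →
        (∃ (α β c : ℂ) (A B : AffMat n m), IsAffine A ∧ IsAffine B ∧ c ≠ 0 ∧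
            A.det = MvPolynomial.C c ∧
            f = MvPolynomial.C α * A.det + MvPolynomial.C β * (A.adjugate * B).trace) →
        n ^ 2 ≤ C * m := by
  rintro ⟨C, n₀, h⟩
  -- block size `s > max C n₀`, `s ≥ 3`; `n = s² = k + 1`; width `m = n·s`
  set s : ℕ := max (max C n₀) 2 + 1 with hs_def
  have hs3 : 3 ≤ s := by omega
  have hsC : C < s := by omega
  have hsn : n₀ ≤ s * s := le_trans (by omega : n₀ ≤ s) (Nat.le_mul_self s)
  obtain ⟨k, hk⟩ : ∃ k, s * s = k + 1 :=
    Nat.exists_eq_succ_of_ne_zero (Nat.mul_pos (by omega) (by omega)).ne'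
  have hprof := chainPoly_profile k s hk hs3
  have hle := h (k + 1) (by omega) ((k + 1) * s) (chainPoly k s hk) hprof.1 hprof.2
    (chainPoly_repr k s hk)
  -- `(k+1)² ≤ C (k+1) s` with `k + 1 = s²` forces `s ≤ C`
  rw [← hk] at hle
  have h1 : s * (s * s * s) ≤ C * (s * s * s) := by nlinarith [hle]
  have h2 : s ≤ C := Nat.le_of_mul_le_mul_right h1 (Nat.mul_pos (Nat.mul_pos (by omega) (by omega)) (by omega))
  omega

end Summit.ValiantsHypothesis.ValiantsHypothesis.Cruxes.TwoDimCoefficients.DimTwoCases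

end
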